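import Summits.PneNP.PneNP.Theses.SzkEntropy
import Literature.Computability.Complexity.PolynomialEntropyApproximation

/-!
# PneNP / SzkEntropy — the target `PeaThreeNotInP` (stmt-PneNP-10776): library bridge and degree monotonicity

Route `PneNP/SzkEntropy`, target item stmt-PneNP-10776 (`PeaThreeNotInP`, thesis X, rank 0):

  `PEA_3 ∉ PromiseP` — no deterministic polynomial-time algorithm approximates, within one bit,
  the Shannon entropy `H(p(U_n))` of a cubic map `p : F₂ⁿ → F₂^m` given sparsely.

X is an OPEN hardness statement (equivalent to `SZKP_L ⊄ prP` by the completeness theorem of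
Dvir–Gutfreund–Rothblum–Vadhan, and stronger than `P ≠ NP` through this route's deciding theorem
`closes`); this file does not settle it.  It records the two elementary facts every later use of
X goes through, as SUPPORT lemmas of the item:

* `szkEntropy_peaThreeNotInP_iff` — the route's inline spelling (`let ev/H/PEA := …; PEA 3 ∉
  PromiseP`, over Mathlib + `Complexity.Promise` only) is DEFINITIONALLY the statement
  `Literature.Computability.Complexity.PEA 3 ∉ PromiseP` about the library's named promise problem
  (`PolynomialEntropyApproximation.lean`), so the library API (`PEA_yes_mono`, `entropy_prod`, …)
  applies to the route decl verbatim;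
* `PEA_not_mem_promiseLift_mono` / `szkEntropy_peaThreeNotInP_iff_forall` — hardness of `PEA_d`
  is MONOTONE in the degree bound: a separating language for `PEA_{d'}` separates `PEA_d` for
  `d ≤ d'` (the instance sets only grow with `d`), hence X is the weakest of the statements
  `PEA_d ∉ PromiseP`, `d ≥ 3`, and follows from any of the statements `PEA_d ∉ PromiseP`, `d ≤ 3`
  (in particular from hardness of the quadratic problem `PEA_2`, cf. crux `PeaTwoMemBPP`).

References: Z. Dvir, D. Gutfreund, G. N. Rothblum, S. Vadhan, *On approximating the entropy of
polynomial mappings*, ICS 2011 (ECCC TR10-160), §3 p. 6 and Thm 1.1 / Thm 4.7;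
O. Goldreich, *On promise problems* (2006), Def. 1.2.
-/

namespace Summit.PneNP.PneNP.Theorems

open Literature.Computability.Complexity

/-- **The route's target is the library's `PEA 3 ∉ PromiseP`.** The inline `let ev/H/PEA := …`
spelling of `PeaThreeNotInP` (route SzkEntropy, item stmt-PneNP-10776) unfolds, definitionally,
to `Literature.Computability.Complexity.PEA 3 ∉ PromiseP` (same encoding
`sigmaBool (listBool³ (encodingFinBool n) × encodingNatBool)`, same yes/no sets, entropy =
`mapEntropy univ eval`). [DvirGutfreundRothblumVadhan2010, §3 p. 6 (the promise problem PEA)] -/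
theorem szkEntropy_peaThreeNotInP_iff :
    Summit.PneNP.PneNP.Theses.SzkEntropy.PeaThreeNotInP ↔ PEA 3 ∉ PromiseP :=
  Iff.rfl

/-- **Promise-class membership of `PEA_d` is antitone in the degree bound**: if some `L ∈ C`
separates `PEA_{d'}` and `d ≤ d'`, the same `L` separates `PEA_d`, because
`(PEA d).yes ⊆ (PEA d').yes` and `(PEA d).no ⊆ (PEA d').no` (`PEA_yes_mono`, `PEA_no_mono`).
[DvirGutfreundRothblumVadhan2010, §3 p. 6; Goldreich2006, Def. 1.2] -/
theorem PEA_mem_promiseLift_of_le {C : Set (Language Bool)} {d d' : ℕ} (h : d ≤ d')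
    (hd' : PEA d' ∈ promiseLift C) : PEA d ∈ promiseLift C := by
  obtain ⟨L, hL, hy, hn⟩ := hd'
  exact ⟨L, hL, (PEA_yes_mono h).trans hy, (PEA_no_mono h).trans hn⟩

/-- **Hardness of `PEA_d` is monotone in `d`**: `PEA d ∉ promiseLift C` and `d ≤ d'` give
`PEA d' ∉ promiseLift C` (contrapositive of `PEA_mem_promiseLift_of_le`).
[DvirGutfreundRothblumVadhan2010, §3 p. 6] -/
theorem PEA_not_mem_promiseLift_mono {C : Set (Language Bool)} {d d' : ℕ} (h : d ≤ d')
    (hd : PEA d ∉ promiseLift C) : PEA d' ∉ promiseLift C :=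
  fun hd' => hd (PEA_mem_promiseLift_of_le h hd')

/-- **X is the weakest cubic-or-higher hardness statement**: `PeaThreeNotInP` holds iff
`PEA d ∉ PromiseP` for every `d ≥ 3` (upward by `PEA_not_mem_promiseLift_mono`, downward at
`d = 3`). [DvirGutfreundRothblumVadhan2010, §3 p. 6 and Thm 1.1] -/
theorem szkEntropy_peaThreeNotInP_iff_forall :
    Summit.PneNP.PneNP.Theses.SzkEntropy.PeaThreeNotInP ↔ ∀ d : ℕ, 3 ≤ d → PEA d ∉ PromiseP := by
  rw [szkEntropy_peaThreeNotInP_iff]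
  exact ⟨fun h d hd => PEA_not_mem_promiseLift_mono hd h, fun h => h 3 le_rfl⟩

/-- **X from hardness in lower degree**: if `PEA d ∉ PromiseP` for some `d ≤ 3` (e.g. if entropy
approximation is already hard for QUADRATIC maps, the negation side of crux `PeaTwoMemBPP` after
derandomisation), then `PeaThreeNotInP`. [DvirGutfreundRothblumVadhan2010, §3 p. 6] -/
theorem szkEntropy_peaThreeNotInP_of_le {d : ℕ} (hd : d ≤ 3) (h : PEA d ∉ PromiseP) :
    Summit.PneNP.PneNP.Theses.SzkEntropy.PeaThreeNotInP :=
  szkEntropy_peaThreeNotInP_iff.2 (PEA_not_mem_promiseLift_mono hd h)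

end Summit.PneNP.PneNP.Theorems
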